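/-
Copyright (c) 2026. All rights reserved.
Released under Apache 2.0 license as described in the file LICENSE.
Authors: abc-iut cell, wave-W6 seat abc-iut-w6-d074 (row THM26II-SIGMA-STAR, abc-iut-L4-lead RULING #7j).
-/
import Literature.AnabelianGeometry.AbsoluteAnabelian.AbsTopIThm26iiSigmaStar
import Literature.AnabelianGeometry.AbsoluteAnabelian.AbsAnabCoinvariantRankGeneralProofs
import Literature.AnabelianGeometry.AbsoluteAnabelian.AbsTopIThm26Thm214RekeyedProofs
import HarnessLib

/-!
# [AbsTopI] Thm 2.6 (ii) AS TYPED for a general prime set `Σ`, from condition (∗)_Σ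

S. Mochizuki, *Topics in Absolute Anabelian Geometry I: Generalities* (2012) [AbsTopI], Thm 2.6 (ii),
manuscript p. 21 (lit key `paper:url-11ac98ba15fc`): "`Π` is topologically finitely generated";
"`δ¹_l(G) = 1` if `l ≠ p`, `δ¹_p(G) = [k : ℚ_p] + 1`"; "the quantity `δ¹_l(Π) − δ¹_l(G)` is `= 0` if
`l ∉ Σ`, and is independent of `l` if `l ∈ Σ`"; "`ε¹_p(Π) = ∞`".  Proof p. 23 l. 15–20: "the existence
of a rational point of `A` over some finite extension of `k` [which determines a Galois section of the
étale fundamental group of `A` over some open subgroup of `G`] implies that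
`δ¹_l(Π) = δ¹_l(G) + dim_{ℚ_l}(Q_l ⊗ ℚ_l)` [where we recall that `dim_{ℚ_l}(Q_l ⊗ ℚ_l)` is independent
of `l`] for `l ∈ Σ`, `δ¹_l(Π) = δ¹_l(G)` for `l ∉ Σ`."

PROOF-ONLY companion (no definition, no named fact, no `sorry`) of abc-iut-L4-t4's statement file
`AbsTopISemiAbsolute.lean` (predicate `FundamentalExtension.Thm26ii B S`) and of the def-bearing
`AbsTopIThm26iiSigmaStar.lean` (`HatZSigmaPow S m = Ẑ_Σ^m`, condition (∗)_Σ
`FundamentalExtension.SigmaStarCondition S`).  The tree's `Ẑ`-shaped closers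
(`thm26ii_of_starCondition_of_isProSet`, `…_of_localEPC`) carry [AbsAnab] (∗) over `Ẑ^m`, which for
`Σ ≠ Primes` forces the rank `m` to vanish (their HONEST SCOPE).  HERE, over the general-target rank
identity (`AbsAnabCoinvariantRankGeneralProofs.lean`, abc-iut-L4-d3's argument with the coinvariant
target abstracted) and the model lemmas of `Ẑ_Σ^m`:

* `FundamentalExtension.exists_freeProlRank_open_eq_add_of_sigmaStar` — GIVEN the splitting over an
  open subgroup of `G` and (∗)_Σ: for every open `Π″ ⊆ Π` ONE `m` with `δ¹_l(Π″) = δ¹_l(G″) + m` for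
  the primes `l ∈ Σ` AND `δ¹_l(Π″) = δ¹_l(G″)` for the primes `l ∉ Σ` — the latter from (∗)_Σ ALONE
  (no "`Δ` pro-`Σ`" hypothesis is needed for it); `…_arith_eq_gal_add_…` — the same at `Π″ = Π`;
* **`FundamentalExtension.thm26ii_of_sigmaStarCondition`** — [AbsTopI] Thm 2.6 (ii) AS TYPED
  (`E.Thm26ii B S`) for EVERY extension with MLF base data and ANY `Σ`, GIVEN "`Π` topologically
  finitely generated", the splitting, and (∗)_Σ — with `m` FREE; the `G`-clauses and "`ε¹_p(Π) = ∞`"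
  are theorems of the tree (abc-iut-L4-t11's `thm26ii_of_clauses`); variants `…_of_geomTFG`
  (Prop 2.2 + "`G` tfg" [NSW 7.5.10], GAP-LEDGER G-L4t4-2) and `…_of_localEPC` (Tate's local
  Euler–Poincaré characteristic for the latter, abc-iut-L4-d1).

HONEST FRAMING: [AbsTopI] is a refereed, undisputed paper; classical profinite group theory; the
inputs (splitting = "rational point over a finite extension", (∗)_Σ = the Tate-module sentence,
Prop 2.2, [NSW] 7.5.10 / local Euler–Poincaré) stay explicit hypotheses; nothing here bears on
[IUTchIII] Cor. 3.12; typed ≠ proved elsewhere.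
-/

noncomputable section

open Topology

universe u

namespace Literature.AnabelianGeometry.AbsoluteAnabelian

namespace FundamentalExtension

variable (E : FundamentalExtension.{u})

/-- `Ẑ_Σ^m` is Hausdorff (a product of the Hausdorff `ℤ_l`; `Multiplicative` carries the same
topology). [folklore] -/
private theorem t2Space_hatZSigmaPow (S : Set ℕ) (m : ℕ) : T2Space (HatZSigmaPow S m) :=
  inferInstanceAs (T2Space (Fin m → ∀ l : {l : ℕ // l.Prime ∧ l ∈ S}, @PadicInt l.1 ⟨l.2.1⟩))

/-- **The rank identity of the proof of [AbsTopI] Thm 2.6 (ii), for every open `Π″ ⊆ Π`**, GIVEN the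
splitting over an open subgroup of `G` ("the existence of a rational point of `A` over some finite
extension of `k`") and (∗)_Σ: there is ONE `m` (the `Ẑ_Σ`-rank of `Δ″/R`) with
`δ¹_l(Π″) = δ¹_l(G″) + m` for every prime `l ∈ Σ`, and `δ¹_l(Π″) = δ¹_l(G″)` for every prime `l ∉ Σ`
(the latter from (∗)_Σ alone).  Print: "`δ¹_l(Π) = δ¹_l(G) + dim_{ℚ_l}(Q_l ⊗ ℚ_l)` […] for `l ∈ Σ`,
`δ¹_l(Π) = δ¹_l(G)` for `l ∉ Σ`". [cite: MochizukiAbsTopI2012, Thm 2.6 (ii) proof p.23] -/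
theorem exists_freeProlRank_open_eq_add_of_sigmaStar (hs : E.SplitsOverOpenSubgroup) {S : Set ℕ}
    (hstarS : E.SigmaStarCondition S) (P : Subgroup E.arith) (hP : IsOpen (P : Set E.arith)) :
    ∃ m : ℕ,
      (∀ (l : ℕ) [Fact l.Prime], l ∈ S →
        freeProlRank P l = freeProlRank (P.map E.aug.toMonoidHom) l + m) ∧
      (∀ (l : ℕ) [Fact l.Prime], l ∉ S →
        freeProlRank P l = freeProlRank (P.map E.aug.toMonoidHom) l) := by
  classical
  obtain ⟨m, q, hq, hqiff⟩ := hstarS P hP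
  haveI : T2Space (HatZSigmaPow S m) := t2Space_hatZSigmaPow S m
  refine ⟨m, fun l _ hlS => ?_, fun l _ hlS => ?_⟩
  · -- `l ∈ Σ`: preimages of the coordinate vectors and the `l`-th projection
    have hdk : ∀ k : Fin m, ∃ d : ↥(E.geom ⊓ P), q d = Multiplicative.ofAdd
        (Pi.single k (1 : ∀ l' : {l : ℕ // l.Prime ∧ l ∈ S}, @PadicInt l'.1 ⟨l'.2.1⟩)) :=
      fun k => hq _
    choose dk hdk using hdk
    obtain ⟨L, hL⟩ := HatZSigmaPow.exists_proj (S := S) (m := m) l hlS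
    refine E.freeProlRank_open_eq_add_of_coinvQuotient hs P hP q hq hqiff l dk ?_ L ?_
    · intro g hg hadd hvan x
      exact HatZSigmaPow.additive_eq_zero_of_apply_single l g hg hadd
        (fun k => by rw [← hdk k]; exact hvan k) x
    · intro j k
      rw [hdk k, hL, toAdd_ofAdd]
      by_cases hjk : j = k
      · subst hjk
        rw [Pi.single_eq_same, if_pos rfl]
        rfl
      · rw [Pi.single_eq_of_ne hjk, if_neg hjk]
        rfl
  · -- `l ∉ Σ`: no characters at all
    exact E.freeProlRank_open_eq_of_coinvQuotient_trivial P hP q hq hqiff l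
      (fun g hg hadd x => HatZSigmaPow.additive_eq_zero_of_not_mem l hlS g hg hadd x)

/-- A subgroup equal to `⊤` is bicontinuously isomorphic to the ambient group. [folklore] -/
private theorem nonempty_continuousMulEquiv_of_eq_top'' {G : Type u} [Group G] [TopologicalSpace G]
    (K : Subgroup G) (h : K = ⊤) : Nonempty (K ≃ₜ* G) :=
  ⟨{ toFun := fun x => (x : G)
     invFun := fun g => ⟨g, h ▸ Subgroup.mem_top g⟩
     left_inv := fun _ => rfl
     right_inv := fun _ => rfl
     map_mul' := fun _ _ => rfl
     continuous_toFun := continuous_subtype_val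
     continuous_invFun := Continuous.subtype_mk continuous_id _ }⟩

/-- The rank identity at `Π″ = Π`, transported along `⊤ ≅ Π`, `aug(⊤) ≅ G`: ONE `m` with
`δ¹_l(Π) = δ¹_l(G) + m` for the primes `l ∈ Σ` and `δ¹_l(Π) = δ¹_l(G)` for the primes `l ∉ Σ`.
[cite: MochizukiAbsTopI2012, Thm 2.6 (ii) proof p.23] -/
theorem exists_freeProlRank_arith_eq_gal_add_of_sigmaStar (hs : E.SplitsOverOpenSubgroup)
    {S : Set ℕ} (hstarS : E.SigmaStarCondition S) :
    ∃ m : ℕ,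
      (∀ (l : ℕ) [Fact l.Prime], l ∈ S → freeProlRank E.arith l = freeProlRank E.gal l + m) ∧
      (∀ (l : ℕ) [Fact l.Prime], l ∉ S → freeProlRank E.arith l = freeProlRank E.gal l) := by
  obtain ⟨m, hon, hoff⟩ := E.exists_freeProlRank_open_eq_add_of_sigmaStar hs hstarS ⊤
    (by rw [Subgroup.coe_top]; exact isOpen_univ)
  obtain ⟨e₁⟩ := nonempty_continuousMulEquiv_of_eq_top'' (⊤ : Subgroup E.arith) rfl
  obtain ⟨e₂⟩ := nonempty_continuousMulEquiv_of_eq_top''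
    ((⊤ : Subgroup E.arith).map E.aug.toMonoidHom) (Subgroup.map_top_of_surjective _ E.aug_surjective)
  refine ⟨m, fun l _ hl => ?_, fun l _ hl => ?_⟩
  · rw [← freeProlRank_eq_of_continuousMulEquiv e₁ l, hon l hl,
      freeProlRank_eq_of_continuousMulEquiv e₂ l]
  · rw [← freeProlRank_eq_of_continuousMulEquiv e₁ l, hoff l hl,
      freeProlRank_eq_of_continuousMulEquiv e₂ l]

/-! ### [AbsTopI] Thm 2.6 (ii) from (∗)_Σ -/

/-- **[AbsTopI] Thm 2.6 (ii) AS TYPED, ANY prime set `Σ`, from (∗)_Σ**: for EVERY extension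
`1 → Δ → Π → G → 1` with MLF base data `G ≅ G_k`, GIVEN (a) "`Π` is topologically finitely generated",
(b) a splitting over an open subgroup of `G` ("the existence of a rational point of `A` over some finite
extension of `k`"), (c) condition (∗)_Σ (`E.SigmaStarCondition S`), the predicate `E.Thm26ii B S` holds —
"`δ¹_l(Π) − δ¹_l(G)` is `= 0` if `l ∉ Σ`, and is independent of `l` if `l ∈ Σ`" being the rank identity
with ONE `m` (free; compare the `m = 0` scope of `thm26ii_of_starCondition_of_isProSet`), the
`G`-clauses and "`ε¹_p(Π) = ∞`" theorems of the tree (`thm26ii_of_clauses`).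
[cite: MochizukiAbsTopI2012, Thm 2.6 (ii) p.21] -/
theorem thm26ii_of_sigmaStarCondition {E : FundamentalExtension.{0}} (B : E.MLFBase) (S : Set ℕ)
    (htfg : IsTopologicallyFinitelyGenerated E.arith) (hs : E.SplitsOverOpenSubgroup)
    (hstarS : E.SigmaStarCondition S) : E.Thm26ii B S := by
  obtain ⟨m, hon, hoff⟩ := E.exists_freeProlRank_arith_eq_gal_add_of_sigmaStar hs hstarS
  have hne : ∀ (l : ℕ) [Fact l.Prime], freeProlRank E.gal l ≠ ⊤ := by
    intro l _
    by_cases hl : l = B.p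
    · subst hl
      rw [(freeProlRank_gal B).2]
      exact ENat.coe_ne_top _
    · rw [(freeProlRank_gal B).1 l hl]
      exact ENat.one_ne_top
  refine thm26ii_of_clauses B S htfg (fun l _ hl => hoff l hl) fun l₁ l₂ _ _ h₁ h₂ => ?_
  rw [hon l₁ h₁, hon l₂ h₂,
    (ENat.addLECancellable_of_ne_top (hne l₁)).add_tsub_cancel_left,
    (ENat.addLECancellable_of_ne_top (hne l₂)).add_tsub_cancel_left]

/-- **[AbsTopI] Thm 2.6 (ii) AS TYPED, ANY `Σ`, printed input list**: GIVEN (a) [AbsTopI] Prop 2.2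
(`E.GeomTFG`), (b) "`G` topologically finitely generated" ([NSW] Thm 7.5.10; GAP-LEDGER G-L4t4-2),
(c) the splitting, (d) (∗)_Σ.  ("the topological finite generation of `Π` follows from that of `Δ`
[cf. Proposition 2.2], together with that of `G` [cf. [NSW], Theorem 7.5.10]".)
[cite: MochizukiAbsTopI2012, Thm 2.6 (ii) p.21] -/
theorem thm26ii_of_sigmaStarCondition_of_geomTFG {E : FundamentalExtension.{0}} (B : E.MLFBase)
    (S : Set ℕ) (hΔ : E.GeomTFG) (hG : IsTopologicallyFinitelyGenerated E.gal)
    (hs : E.SplitsOverOpenSubgroup) (hstarS : E.SigmaStarCondition S) : E.Thm26ii B S :=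
  thm26ii_of_sigmaStarCondition B S
    (IsTopologicallyFinitelyGenerated.of_extension E.aug E.aug_surjective hΔ hG) hs hstarS

/-- **[AbsTopI] Thm 2.6 (ii) AS TYPED, ANY `Σ`**, with "`G` topologically finitely generated" supplied
by Tate's local Euler–Poincaré characteristic (`MLFBase.isTopologicallyFinitelyGenerated_gal_of_localEPC`):
GIVEN Prop 2.2, the local Euler–Poincaré characteristic, the splitting, and (∗)_Σ.
[cite: MochizukiAbsTopI2012, Thm 2.6 (ii) p.21] -/
theorem thm26ii_of_sigmaStarCondition_of_localEPC {E : FundamentalExtension.{0}} (B : E.MLFBase)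
    (S : Set ℕ) (hΔ : E.GeomTFG)
    (hEP : ∀ (F : Type) [Field F] [ValuativeRel F] [TopologicalSpace F]
      [IsNonarchimedeanLocalField F] [CharZero F],
      Literature.NumberTheory.GaloisRepresentations.localEulerPoincareCharacteristic F)
    (hs : E.SplitsOverOpenSubgroup) (hstarS : E.SigmaStarCondition S) : E.Thm26ii B S :=
  thm26ii_of_sigmaStarCondition_of_geomTFG B S hΔ
    (B.isTopologicallyFinitelyGenerated_gal_of_localEPC hEP) hs hstarS

end FundamentalExtension

end Literature.AnabelianGeometry.AbsoluteAnabelian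

end
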